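import Summits.NavierStokesRegularity.NavierStokesRegularity.Theorems.OddMorawetzMorawetzKillsTypeIIsoNullThreeFrame
import Summits.NavierStokesRegularity.NavierStokesRegularity.Theorems.OddMorawetzMorawetzKillsTypeIIsoStructureThreeCanon

/-!
# Crux `MorawetzKillsTypeI` — frame for the weight-3 null-Lagrangian certificates, part B

Coordinate tools for the generated proofs of `stub_isoNullThree` (crux stmt-NavierStokesRegularity-1377, line
`registered`): the vorticity form `r = ω · ∇u ω` of the registered statement written as a polynomial in the
coordinates `jcA` (`r_expand`, registration hook `isoNullThree_r`), its smoothness, linearity of a `1`-multilinear map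
in its constant argument, and the trace-elimination rules on symmetric trace-free jets (`trace_elim`, index lists
generated by the lead's `compute/gen_n3.py`). Everything is proved; no definitions.
-/

noncomputable section

open scoped BigOperators

set_option linter.dupNamespace false
set_option linter.unusedSimpArgs false

namespace Summit.NavierStokesRegularity.NavierStokesRegularity.Theorems

open Literature.Analysis.FluidPDE
open Summit.NavierStokesRegularity.NavierStokesRegularity.Theorems.OddMorawetz

namespace IsoNullThree

/-- A `1`-multilinear map applied to a constant family is linear in the constant: coordinates. -/
theorem apply_const_coord (A : E3 [×1]→L[ℝ] E3) (x : E3) (a : Fin 3) :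
    A (fun _ => x) a = ∑ b : Fin 3, x b * A (fun _ => EuclideanSpace.single b (1 : ℝ)) a := by
  have hu : ∀ v : E3, (fun _ : Fin 1 => v) = Function.update (fun _ : Fin 1 => (0 : E3)) 0 v := by
    intro v; funext s; fin_cases s; simp
  have hL : ∀ v : E3, A (fun _ => v) = A.toContinuousLinearMap (fun _ => 0) 0 v := by
    intro v; rw [hu v]; rfl
  simp only [hL]
  exact SymBasis.apply_coord _ x a

/-- **The vorticity form in coordinates** (registration hook `isoNullThree_r`, crux stmt-NavierStokesRegularity-1377):
`r(z) = ω · (∇u ω) = ∑_{a b} ω_a ω_b A_{ab}` with `ω = (A₂₁ - A₁₂, A₀₂ - A₂₀, A₁₀ - A₀₁)`. -/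
theorem isoNullThree_r : ∀ z : Jet3,
    inner ℝ (WithLp.toLp 2 ![z.2.1 (fun _ => EuclideanSpace.single 1 (1 : ℝ)) 2 - z.2.1 (fun _ => EuclideanSpace.single 2 (1 : ℝ)) 1, z.2.1 (fun _ => EuclideanSpace.single 2 (1 : ℝ)) 0 - z.2.1 (fun _ => EuclideanSpace.single 0 (1 : ℝ)) 2, z.2.1 (fun _ => EuclideanSpace.single 0 (1 : ℝ)) 1 - z.2.1 (fun _ => EuclideanSpace.single 1 (1 : ℝ)) 0]) (z.2.1 (fun _ => WithLp.toLp 2 ![z.2.1 (fun _ => EuclideanSpace.single 1 (1 : ℝ)) 2 - z.2.1 (fun _ => EuclideanSpace.single 2 (1 : ℝ)) 1, z.2.1 (fun _ => EuclideanSpace.single 2 (1 : ℝ)) 0 - z.2.1 (fun _ => EuclideanSpace.single 0 (1 : ℝ)) 2, z.2.1 (fun _ => EuclideanSpace.single 0 (1 : ℝ)) 1 - z.2.1 (fun _ => EuclideanSpace.single 1 (1 : ℝ)) 0])) =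
      ∑ a : Fin 3, ∑ b : Fin 3, (![jcA 2 1 - jcA 1 2, jcA 0 2 - jcA 2 0, jcA 1 0 - jcA 0 1] : Fin 3 → (Jet3 →L[ℝ] ℝ)) a z *
        (![jcA 2 1 - jcA 1 2, jcA 0 2 - jcA 2 0, jcA 1 0 - jcA 0 1] : Fin 3 → (Jet3 →L[ℝ] ℝ)) b z * jcA a b z := by
  intro z
  rw [PiLp.inner_apply]
  simp only [apply_const_coord (z.2.1) (WithLp.toLp 2 ![z.2.1 (fun _ => EuclideanSpace.single 1 (1 : ℝ)) 2 - z.2.1 (fun _ => EuclideanSpace.single 2 (1 : ℝ)) 1, z.2.1 (fun _ => EuclideanSpace.single 2 (1 : ℝ)) 0 - z.2.1 (fun _ => EuclideanSpace.single 0 (1 : ℝ)) 2, z.2.1 (fun _ => EuclideanSpace.single 0 (1 : ℝ)) 1 - z.2.1 (fun _ => EuclideanSpace.single 1 (1 : ℝ)) 0])]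
  simp only [RCLike.inner_apply, conj_trivial, PiLp.toLp_apply, Fin.sum_univ_three, Fin.isValue, Matrix.cons_val_zero,
    Matrix.cons_val_one, Matrix.cons_val_two, Matrix.head_cons, Matrix.tail_cons, IsoStructureThree.coordA, sub_apply]
  ring

/-- The vorticity form is smooth. -/
theorem contDiff_r (n : ℕ∞) : ContDiff ℝ n (fun z : Jet3 => inner ℝ (WithLp.toLp 2 ![z.2.1 (fun _ => EuclideanSpace.single 1 (1 : ℝ)) 2 - z.2.1 (fun _ => EuclideanSpace.single 2 (1 : ℝ)) 1, z.2.1 (fun _ => EuclideanSpace.single 2 (1 : ℝ)) 0 - z.2.1 (fun _ => EuclideanSpace.single 0 (1 : ℝ)) 2, z.2.1 (fun _ => EuclideanSpace.single 0 (1 : ℝ)) 1 - z.2.1 (fun _ => EuclideanSpace.single 1 (1 : ℝ)) 0]) (z.2.1 (fun _ => WithLp.toLp 2 ![z.2.1 (fun _ => EuclideanSpace.single 1 (1 : ℝ)) 2 - z.2.1 (fun _ => EuclideanSpace.single 2 (1 : ℝ)) 1, z.2.1 (fun _ => EuclideanSpace.single 2 (1 : ℝ)) 0 - z.2.1 (fun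 _ => EuclideanSpace.single 0 (1 : ℝ)) 2, z.2.1 (fun _ => EuclideanSpace.single 0 (1 : ℝ)) 1 - z.2.1 (fun _ => EuclideanSpace.single 1 (1 : ℝ)) 0]))) := by
  rw [show (fun z : Jet3 => inner ℝ (WithLp.toLp 2 ![z.2.1 (fun _ => EuclideanSpace.single 1 (1 : ℝ)) 2 - z.2.1 (fun _ => EuclideanSpace.single 2 (1 : ℝ)) 1, z.2.1 (fun _ => EuclideanSpace.single 2 (1 : ℝ)) 0 - z.2.1 (fun _ => EuclideanSpace.single 0 (1 : ℝ)) 2, z.2.1 (fun _ => EuclideanSpace.single 0 (1 : ℝ)) 1 - z.2.1 (fun _ => EuclideanSpace.single 1 (1 : ℝ)) 0]) (z.2.1 (fun _ => WithLp.toLp 2 ![z.2.1 (fun _ => EuclideanSpace.single 1 (1 : ℝ)) 2 - z.2.1 (fun _ => EuclideanSpace.single 2 (1 : ℝ)) 1, z.2.1 (fun _ => EuclideanSpace.single 2 (1 : ℝ)) 0 - z.2.1 (fun _ => EuclideanSpace.single 0 (1 : ℝ)) 2, z.2.1 (fun _ => EuclideanSpace.single 0 (1 : ℝ)) 1 - z.2.1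 (fun _ => EuclideanSpace.single 1 (1 : ℝ)) 0]))) = fun z =>
      ∑ a : Fin 3, ∑ b : Fin 3, (![jcA 2 1 - jcA 1 2, jcA 0 2 - jcA 2 0, jcA 1 0 - jcA 0 1] : Fin 3 → (Jet3 →L[ℝ] ℝ)) a z *
        (![jcA 2 1 - jcA 1 2, jcA 0 2 - jcA 2 0, jcA 1 0 - jcA 0 1] : Fin 3 → (Jet3 →L[ℝ] ℝ)) b z * jcA a b z from funext isoNullThree_r]
  exact ContDiff.sum fun a _ => ContDiff.sum fun b _ =>
    (((![jcA 2 1 - jcA 1 2, jcA 0 2 - jcA 2 0, jcA 1 0 - jcA 0 1] : Fin 3 → (Jet3 →L[ℝ] ℝ)) a).contDiff.mul ((![jcA 2 1 - jcA 1 2, jcA 0 2 - jcA 2 0, jcA 1 0 - jcA 0 1] : Fin 3 → (Jet3 →L[ℝ] ℝ)) b).contDiff).mul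
      (jcA a b).contDiff

/-- **Trace elimination.** On a symmetric jet whose first slots are trace free, every coordinate with first index `2`
and a derivative index `2` is minus the sum of the two corresponding coordinates with first index `0`, `1`
(indices sorted; generated list). -/
theorem trace_elim (z : Jet3) (hz2 : ∀ (h : Fin 2 → E3) (σ : Equiv.Perm (Fin 2)), z.2.2.1 (h ∘ σ) = z.2.2.1 h)
    (hz3 : ∀ (h : Fin 3 → E3) (σ : Equiv.Perm (Fin 3)), z.2.2.2 (h ∘ σ) = z.2.2.2 h)
    (hA : ∑ a : Fin 3, jcA a a z = 0) (hH : ∀ j : Fin 3, ∑ a : Fin 3, jcH a a j z = 0)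
    (hT : ∀ j k : Fin 3, ∑ a : Fin 3, jcT a a j k z = 0) :
    (jcA 2 2 z = -jcA 0 0 z - jcA 1 1 z) ∧
    (jcH 2 0 2 z = -jcH 0 0 0 z - jcH 1 0 1 z) ∧
    (jcH 2 1 2 z = -jcH 0 0 1 z - jcH 1 1 1 z) ∧
    (jcH 2 2 2 z = -jcH 0 0 2 z - jcH 1 1 2 z) ∧
    (jcT 2 0 0 2 z = -jcT 0 0 0 0 z - jcT 1 0 0 1 z) ∧
    (jcT 2 0 1 2 z = -jcT 0 0 0 1 z - jcT 1 0 1 1 z) ∧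
    (jcT 2 0 2 2 z = -jcT 0 0 0 2 z - jcT 1 0 1 2 z) ∧
    (jcT 2 1 1 2 z = -jcT 0 0 1 1 z - jcT 1 1 1 1 z) ∧
    (jcT 2 1 2 2 z = -jcT 0 0 1 2 z - jcT 1 1 1 2 z) ∧
    (jcT 2 2 2 2 z = -jcT 0 0 2 2 z - jcT 1 1 2 2 z) := by
  obtain ⟨c1, c2, c3⟩ := IsoStructureThree.cf2_canon z hz2
  obtain ⟨d1, d2, d3, d4, d5, d6, d7, d8, d9, d10, d11, d12, d13, d14, d15, d16, d17⟩ := IsoStructureThree.cf3_canon z hz3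
  refine ⟨?_, ?_, ?_, ?_, ?_, ?_, ?_, ?_, ?_, ?_⟩
  · have h := hA
    simp only [Fin.sum_univ_three, Fin.isValue, c1, c2, c3, d1, d2, d3, d4, d5, d6, d7, d8, d9, d10, d11, d12, d13, d14, d15, d16, d17] at h
    linear_combination h
  · have h := hH 0
    simp only [Fin.sum_univ_three, Fin.isValue, c1, c2, c3, d1, d2, d3, d4, d5, d6, d7, d8, d9, d10, d11, d12, d13, d14, d15, d16, d17] at h
    linear_combination h
  · have h := hH 1
    simp only [Fin.sum_univ_three, Fin.isValue, c1, c2, c3, d1, d2, d3, d4, d5, d6, d7, d8, d9, d10, d11, d12, d13, d14, d15, d16, d17] at h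
    linear_combination h
  · have h := hH 2
    simp only [Fin.sum_univ_three, Fin.isValue, c1, c2, c3, d1, d2, d3, d4, d5, d6, d7, d8, d9, d10, d11, d12, d13, d14, d15, d16, d17] at h
    linear_combination h
  · have h := hT 0 0
    simp only [Fin.sum_univ_three, Fin.isValue, c1, c2, c3, d1, d2, d3, d4, d5, d6, d7, d8, d9, d10, d11, d12, d13, d14, d15, d16, d17] at h
    linear_combination h
  · have h := hT 0 1
    simp only [Fin.sum_univ_three, Fin.isValue, c1, c2, c3, d1, d2, d3, d4, d5, d6, d7, d8, d9, d10, d11, d12, d13, d14, d15, d16, d17] at h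
    linear_combination h
  · have h := hT 0 2
    simp only [Fin.sum_univ_three, Fin.isValue, c1, c2, c3, d1, d2, d3, d4, d5, d6, d7, d8, d9, d10, d11, d12, d13, d14, d15, d16, d17] at h
    linear_combination h
  · have h := hT 1 1
    simp only [Fin.sum_univ_three, Fin.isValue, c1, c2, c3, d1, d2, d3, d4, d5, d6, d7, d8, d9, d10, d11, d12, d13, d14, d15, d16, d17] at h
    linear_combination h
  · have h := hT 1 2
    simp only [Fin.sum_univ_three, Fin.isValue, c1, c2, c3, d1, d2, d3, d4, d5, d6, d7, d8, d9, d10, d11, d12, d13, d14, d15, d16, d17] at h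
    linear_combination h
  · have h := hT 2 2
    simp only [Fin.sum_univ_three, Fin.isValue, c1, c2, c3, d1, d2, d3, d4, d5, d6, d7, d8, d9, d10, d11, d12, d13, d14, d15, d16, d17] at h
    linear_combination h

end IsoNullThree

end Summit.NavierStokesRegularity.NavierStokesRegularity.Theorems

end
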